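import Summits.QuantumFields.BalabanUV.T4Continuum.Support.ShellMeasureCubicTaylor

/-!
# `T4Continuum.ShellMeasureCubicWord` — THE CUBIC WORD ALGEBRA of a product of four exponentials under a cyclic
# functional: the BCH-free core of [Balaban1985Variational] (34)–(39) (file 2 of 3 of «S65 f4»)

Cell `pub-balaban`, sub-cell `t4`, spine estimate NE7c (node U5b), NE7c ROUND-2 crew `t4-ne7c-formalise-*`, unit
`b2b-balaban-t4-ne7c-formalise-leaf-03` gen 4; OFFER «S65 f4» (journal `CLAIMS.log`).  ADDITIVE: imports file 1
`ShellMeasureCubicTaylor` ONLY (for the word polynomials `polyL`∕`polyC`); modifies nothing; [folklore] pure algebra in a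
ℂ-algebra; 0 `def … : Prop`, 0 sorry, 0 citation tags.

HONEST FRAMING.  Finite four-torus programme, rung (B)+1 only — NOT infinite volume, NOT a mass gap, NOT the Clay
problem, NOT summit progress.  NE7c (`T4IndicatorShell.ShellWeightBound`) is NOT PRINTED and NOT PROVED; «NE7c ⇐ the
named binders».  Nothing of [Balaban1985Variational] is asserted: its (34)–(39) (the Baker–Campbell–Hausdorff route to
the third-order term `V⁽³⁾(A, ∂p)` of the one-plaquette action, pp. 283–284, and the split (39) «V₀(A, ∂p) =
¼ i tr(DA)(p)·Σ_{b₁<b₂} i[A′(b₁), A′(b₂)] + V₀′(A, ∂p)») are LOCATORS for the SHAPE reproduced here WITHOUT BCH, as plain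
algebra.  HONEST DEPENDENCY (cell, verbatim): continuum YM on T⁴ ⇐ BetaPertH ∧ nine spine estimates (0/9 proved);
BetaPertH ⇐ (D1) ∧ (D4) ∧ CAP+tail; G-an2-4 gates asym, D1 and NE2/3/4.

WHAT IS PROVED.  For a ℂ-linear functional `τ` on a normed ℂ-algebra `𝔸` with the TRACE PROPERTY `τ (X * Y) = τ (Y * X)`
(a hypothesis; e.g. a normalised matrix trace) and four elements `y₁ y₂ y₃ y₄` — `curl4 = y₁ + y₂ + y₃ + y₄` (print's
`η(DA)(p)` after the twisting dictionary of file 3), `comm4 = Σ_{i<j}(yᵢyⱼ − yⱼyᵢ)` (print's `Σ_{b₁<b₂}[A′(b₁), A′(b₂)]`):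
* `polyL_four_add_rev`: the linear parts of the word `e^{y₁}e^{y₂}e^{y₃}e^{y₄}` and of its REVERSED INVERSE
  `e^{−y₄}e^{−y₃}e^{−y₂}e^{−y₁}` cancel;
* **`trace_polyC_add_rev`**: `τ (polyC [y₁,y₂,y₃,y₄]) + τ (polyC [−y₄,−y₃,−y₂,−y₁]) = τ (curl4 · comm4)` — the cubic
  parts of the word and of its reversed inverse, read through a trace, are the SINGLE curl × commutator term: the `y³`
  words cancel outright, the `y²y` words cancel by cyclicity, each triple `i<j<k` leaves `τ(yᵢ[yⱼ, yₖ])`, and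
  `Σ_{i<j<k} τ(yᵢ[yⱼ, yₖ]) = τ((Σᵢyᵢ)·Σ_{j<k}[yⱼ, yₖ])` (the words with a repeated index drop out by cyclicity).  The
  proof is a kernel-checked bookkeeping of 52 words: both sides expanded (`module`), then ONE `linear_combination` of 36
  cyclic rotations `τ(a(bc)) = τ(b(ca))`.
This is the mechanism behind print's sentence (p. 284) «The first trace on the right-hand side of (36) depends on the
derivative (DA)(p), the remaining expressions depend on the field variables A only»: for the Re-paired (word + reversed
inverse word) functional the «remaining expressions» vanish IDENTICALLY at `U₀(∂p) = 1`, so that at a general background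
they carry the small factor `U₀(∂p) − 1` (file 3).
-/

noncomputable section

open scoped BigOperators

namespace Summit.QuantumFields.BalabanUV.T4Continuum.ShellMeasureCubicWord

open ShellMeasureCubicTaylor (polyL polyQ polyC polyL_cons polyL_nil polyQ_cons polyQ_nil polyC_cons polyC_nil)

section Cyclic

variable {𝔸 : Type*} [NormedRing 𝔸] [NormedAlgebra ℂ 𝔸]

/-- The «curl» of four letters: `Y = y₁ + y₂ + y₃ + y₄`. [folklore] -/
def curl4 (y₁ y₂ y₃ y₄ : 𝔸) : 𝔸 := y₁ + y₂ + y₃ + y₄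

/-- The ordered commutator sum of four letters: `K = Σ_{i<j} (yᵢyⱼ − yⱼyᵢ)`. [folklore] -/
def comm4 (y₁ y₂ y₃ y₄ : 𝔸) : 𝔸 :=
  (y₁ * y₂ - y₂ * y₁) + (y₁ * y₃ - y₃ * y₁) + (y₁ * y₄ - y₄ * y₁)
    + (y₂ * y₃ - y₃ * y₂) + (y₂ * y₄ - y₄ * y₂) + (y₃ * y₄ - y₄ * y₃)

omit [NormedAlgebra ℂ 𝔸] in
/-- The linear parts of a word and of its reversed inverse cancel. [folklore] -/
theorem polyL_four_add_rev (y₁ y₂ y₃ y₄ : 𝔸) :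
    polyL [y₁, y₂, y₃, y₄] + polyL [-y₄, -y₃, -y₂, -y₁] = 0 := by
  simp only [polyL_cons, polyL_nil]
  abel

variable (τ : 𝔸 →ₗ[ℂ] ℂ)

/-- Cyclic rotation of a triple product under a functional with the trace property. [folklore] -/
theorem cyc3 (hτ : ∀ X Y : 𝔸, τ (X * Y) = τ (Y * X)) (a b c : 𝔸) : τ (a * b * c) = τ (c * a * b) := by
  rw [hτ (a * b) c, ← mul_assoc]

/-- **THE CUBIC WORD ALGEBRA** ([Balaban1985Variational] (36)→(39), BCH-free): under a functional with the trace property,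
the cubic part of `e^{y₁}e^{y₂}e^{y₃}e^{y₄}` plus the cubic part of the reversed inverse word `e^{−y₄}e^{−y₃}e^{−y₂}e^{−y₁}`
is the single curl × commutator term: `τ(polyC [y₁,y₂,y₃,y₄]) + τ(polyC [−y₄,−y₃,−y₂,−y₁]) = τ (Y * K)`,
`Y = Σᵢ yᵢ`, `K = Σ_{i<j}[yᵢ, yⱼ]` (the `y³` and `y²y` words cancel by cyclicity; each triple `i<j<k` leaves
`τ(yᵢ[yⱼ,yₖ])`, and `Σ_{i<j<k} τ(yᵢ[yⱼ,yₖ]) = τ(Y·K)`). [folklore] -/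
theorem trace_polyC_add_rev (hτ : ∀ X Y : 𝔸, τ (X * Y) = τ (Y * X)) (y₁ y₂ y₃ y₄ : 𝔸) :
    τ (polyC [y₁, y₂, y₃, y₄]) + τ (polyC [-y₄, -y₃, -y₂, -y₁]) =
      τ (curl4 y₁ y₂ y₃ y₄ * comm4 y₁ y₂ y₃ y₄) := by
  have rot : ∀ a b c : 𝔸, τ (a * (b * c)) = τ (b * (c * a)) := fun a b c => by
    rw [hτ a (b * c), mul_assoc]
  -- the two cubic polynomials, expanded into right-associated words (32 words; the `y³` words cancel outright)
  have h1 : polyC [y₁, y₂, y₃, y₄] + polyC [-y₄, -y₃, -y₂, -y₁] =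
      ((1 : ℂ) / 2) • (y₁ * (y₁ * y₂)) + ((1 : ℂ) / 2) • (y₁ * (y₁ * y₃)) + ((1 : ℂ) / 2) • (y₁ * (y₁ * y₄)) + ((1 :
      ℂ) / 2) • (y₁ * (y₂ * y₂)) + (1 : ℂ) • (y₁ * (y₂ * y₃)) + (1 : ℂ) • (y₁ * (y₂ * y₄)) + ((1 : ℂ) / 2) • (y₁ *
      (y₃ * y₃)) + (1 : ℂ) • (y₁ * (y₃ * y₄)) + ((1 : ℂ) / 2) • (y₁ * (y₄ * y₄)) + ((-1 : ℂ) / 2) • (y₂ * (y₁ * y₁))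
      + ((-1 : ℂ) / 2) • (y₂ * (y₂ * y₁)) + ((1 : ℂ) / 2) • (y₂ * (y₂ * y₃)) + ((1 : ℂ) / 2) • (y₂ * (y₂ * y₄)) +
      ((1 : ℂ) / 2) • (y₂ * (y₃ * y₃)) + (1 : ℂ) • (y₂ * (y₃ * y₄)) + ((1 : ℂ) / 2) • (y₂ * (y₄ * y₄)) + ((-1 : ℂ) /
      2) • (y₃ * (y₁ * y₁)) + (-1 : ℂ) • (y₃ * (y₂ * y₁)) + ((-1 : ℂ) / 2) • (y₃ * (y₂ * y₂)) + ((-1 : ℂ) / 2) • (y₃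
      * (y₃ * y₁)) + ((-1 : ℂ) / 2) • (y₃ * (y₃ * y₂)) + ((1 : ℂ) / 2) • (y₃ * (y₃ * y₄)) + ((1 : ℂ) / 2) • (y₃ *
      (y₄ * y₄)) + ((-1 : ℂ) / 2) • (y₄ * (y₁ * y₁)) + (-1 : ℂ) • (y₄ * (y₂ * y₁)) + ((-1 : ℂ) / 2) • (y₄ * (y₂ *
      y₂)) + (-1 : ℂ) • (y₄ * (y₃ * y₁)) + (-1 : ℂ) • (y₄ * (y₃ * y₂)) + ((-1 : ℂ) / 2) • (y₄ * (y₃ * y₃)) + ((-1 :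
      ℂ) / 2) • (y₄ * (y₄ * y₁)) + ((-1 : ℂ) / 2) • (y₄ * (y₄ * y₂)) + ((-1 : ℂ) / 2) • (y₄ * (y₄ * y₃)) := by
    simp only [polyC_cons, polyC_nil, polyQ_cons, polyQ_nil, polyL_cons, polyL_nil, mul_add, smul_mul_assoc,
      mul_smul_comm, mul_assoc, neg_mul, mul_neg, smul_neg, neg_neg, add_zero, mul_zero]
    module
  -- the curl × commutator product, expanded (48 words)
  have h2 : curl4 y₁ y₂ y₃ y₄ * comm4 y₁ y₂ y₃ y₄ =
      (1 : ℂ) • (y₁ * (y₁ * y₂)) + (1 : ℂ) • (y₁ * (y₁ * y₃)) + (1 : ℂ) • (y₁ * (y₁ * y₄)) + (-1 : ℂ) • (y₁ * (y₂ *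
      y₁)) + (1 : ℂ) • (y₁ * (y₂ * y₃)) + (1 : ℂ) • (y₁ * (y₂ * y₄)) + (-1 : ℂ) • (y₁ * (y₃ * y₁)) + (-1 : ℂ) • (y₁
      * (y₃ * y₂)) + (1 : ℂ) • (y₁ * (y₃ * y₄)) + (-1 : ℂ) • (y₁ * (y₄ * y₁)) + (-1 : ℂ) • (y₁ * (y₄ * y₂)) + (-1 :
      ℂ) • (y₁ * (y₄ * y₃)) + (1 : ℂ) • (y₂ * (y₁ * y₂)) + (1 : ℂ) • (y₂ * (y₁ * y₃)) + (1 : ℂ) • (y₂ * (y₁ * y₄)) +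
      (-1 : ℂ) • (y₂ * (y₂ * y₁)) + (1 : ℂ) • (y₂ * (y₂ * y₃)) + (1 : ℂ) • (y₂ * (y₂ * y₄)) + (-1 : ℂ) • (y₂ * (y₃ *
      y₁)) + (-1 : ℂ) • (y₂ * (y₃ * y₂)) + (1 : ℂ) • (y₂ * (y₃ * y₄)) + (-1 : ℂ) • (y₂ * (y₄ * y₁)) + (-1 : ℂ) • (y₂
      * (y₄ * y₂)) + (-1 : ℂ) • (y₂ * (y₄ * y₃)) + (1 : ℂ) • (y₃ * (y₁ * y₂)) + (1 : ℂ) • (y₃ * (y₁ * y₃)) + (1 : ℂ)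
      • (y₃ * (y₁ * y₄)) + (-1 : ℂ) • (y₃ * (y₂ * y₁)) + (1 : ℂ) • (y₃ * (y₂ * y₃)) + (1 : ℂ) • (y₃ * (y₂ * y₄)) +
      (-1 : ℂ) • (y₃ * (y₃ * y₁)) + (-1 : ℂ) • (y₃ * (y₃ * y₂)) + (1 : ℂ) • (y₃ * (y₃ * y₄)) + (-1 : ℂ) • (y₃ * (y₄
      * y₁)) + (-1 : ℂ) • (y₃ * (y₄ * y₂)) + (-1 : ℂ) • (y₃ * (y₄ * y₃)) + (1 : ℂ) • (y₄ * (y₁ * y₂)) + (1 : ℂ) •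
      (y₄ * (y₁ * y₃)) + (1 : ℂ) • (y₄ * (y₁ * y₄)) + (-1 : ℂ) • (y₄ * (y₂ * y₁)) + (1 : ℂ) • (y₄ * (y₂ * y₃)) + (1
      : ℂ) • (y₄ * (y₂ * y₄)) + (-1 : ℂ) • (y₄ * (y₃ * y₁)) + (-1 : ℂ) • (y₄ * (y₃ * y₂)) + (1 : ℂ) • (y₄ * (y₃ *
      y₄)) + (-1 : ℂ) • (y₄ * (y₄ * y₁)) + (-1 : ℂ) • (y₄ * (y₄ * y₂)) + (-1 : ℂ) • (y₄ * (y₄ * y₃)) := by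
    simp only [curl4, comm4, mul_add, add_mul, mul_sub, one_smul, neg_smul]
    module
  rw [← map_add, h1, h2]
  simp only [map_add, map_smul, smul_eq_mul]
  linear_combination
    ((-1 : ℂ) / 2) * rot y₁ y₁ y₂ + ((1 : ℂ) / 2) * rot y₁ y₂ y₁ + ((-1 : ℂ) / 2) * rot y₁ y₁ y₃ + ((1 : ℂ) / 2) *
    rot y₁ y₃ y₁ + ((-1 : ℂ) / 2) * rot y₁ y₁ y₄ + ((1 : ℂ) / 2) * rot y₁ y₄ y₁ + ((1 : ℂ) / 2) * rot y₁ y₂ y₂ + (1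
    : ℂ) * rot y₂ y₂ y₁ + ((1 : ℂ) / 2) * rot y₁ y₃ y₃ + (1 : ℂ) * rot y₃ y₃ y₁ + ((1 : ℂ) / 2) * rot y₁ y₄ y₄ + (1
    : ℂ) * rot y₄ y₄ y₁ + ((-1 : ℂ) / 2) * rot y₂ y₂ y₃ + ((1 : ℂ) / 2) * rot y₂ y₃ y₂ + ((-1 : ℂ) / 2) * rot y₂ y₂
    y₄ + ((1 : ℂ) / 2) * rot y₂ y₄ y₂ + ((1 : ℂ) / 2) * rot y₂ y₃ y₃ + (1 : ℂ) * rot y₃ y₃ y₂ + ((1 : ℂ) / 2) * rot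
    y₂ y₄ y₄ + (1 : ℂ) * rot y₄ y₄ y₂ + ((-1 : ℂ) / 2) * rot y₃ y₃ y₄ + ((1 : ℂ) / 2) * rot y₃ y₄ y₃ + ((1 : ℂ) / 2)
    * rot y₃ y₄ y₄ + (1 : ℂ) * rot y₄ y₄ y₃ + (1 : ℂ) * rot y₁ y₃ y₂ + (1 : ℂ) * rot y₃ y₂ y₁ + (1 : ℂ) * rot y₁ y₄
    y₂ + (1 : ℂ) * rot y₄ y₂ y₁ + (1 : ℂ) * rot y₁ y₄ y₃ + (1 : ℂ) * rot y₄ y₃ y₁ + (1 : ℂ) * rot y₂ y₃ y₁ + (1 : ℂ)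
    * rot y₂ y₄ y₁ + (1 : ℂ) * rot y₂ y₄ y₃ + (1 : ℂ) * rot y₄ y₃ y₂ + (1 : ℂ) * rot y₃ y₄ y₁ + (1 : ℂ) * rot y₃ y₄
    y₂

end Cyclic

end Summit.QuantumFields.BalabanUV.T4Continuum.ShellMeasureCubicWord

end
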